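import Mathlib
import Summits.Ventures.PercRepro2.Tail2DBlockCalc
import Summits.Ventures.PercRepro2.Tail2DHarrisSP
import Summits.Ventures.PercRepro2.Tail2DFlowOneBlocks
import Summits.Ventures.PercRepro2.Tail2DFlowOneStep01
import Summits.Ventures.PercRepro2.Tail2DParFin
import Summits.Ventures.PercRepro2.Tail2DParFinFlip
import Summits.Ventures.PercRepro2.Tail2DParFinDiag

/-!
# (SD) at the top-level positions `(u, k−u)` on parallel compositions of `k` flow-one factors, for every `k`
(seat mine-b, cell pub-perc-repro2; conjectures/MINE-B.md §43)

At a position `(u, v)` with `u + v = k` every configuration of the source tail has ALL factors crossing — its word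
has exactly `u` `R`s and `v` `B`s — and the target words have `u−1` `R`s and `v+1` `B`s; all these blocks have the
same size `A = Π a_i`, so `|E(u,v)| = C(k,u)·A` and `|E(u−1,v+1)| = C(k,u−1)·A`.  The certificate: every source
word flips a UNIFORMLY RANDOM one of its `u` reds (weight `|w|/(|E|·u)`); a target word receives one term from each
of its `v+1` blues, and `C(k,u−1)·(v+1) = C(k,u)·u`.  Hence `sdomZ_parFin_top`: (SD) at every `(u, k−u)`,
`1 ≤ u ≤ k`, for any `k` flow-one factors.
-/

namespace Summit.Ventures.PercRepro2.Tail2D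

open V2Closure Finset

section Words

variable (k : ℕ)

/-- the numbers of reds and blues of a word are at most `k` together -/
theorem nR_add_nB_le (w : Fin k → Ltr) : nR k w + nB k w ≤ k := by
  unfold nR nB
  rw [← Finset.card_union_of_disjoint]
  · exact le_trans (Finset.card_le_univ _) (by simp)
  · rw [Finset.disjoint_left]
    intro i h1 h2
    simp only [Finset.mem_filter, Finset.mem_univ, true_and] at h1 h2
    rw [h1] at h2
    exact Ltr.noConfusion h2

/-- the all-crossing word with reds on `S` -/
def mkWord (S : Finset (Fin k)) : Fin k → Ltr := fun i => if i ∈ S then Ltr.R else Ltr.B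

/-- the reds of `mkWord S` are `S` -/
theorem redSet_mkWord (S : Finset (Fin k)) : redSet k (mkWord k S) = S := by
  ext i
  simp only [redSet, mkWord, Finset.mem_filter, Finset.mem_univ, true_and]
  by_cases hi : i ∈ S <;> simp [hi]

/-- the blues of `mkWord S` are the complement of `S` -/
theorem blueSet_mkWord (S : Finset (Fin k)) : blueSet k (mkWord k S) = Sᶜ := by
  ext i
  simp only [blueSet, mkWord, Finset.mem_filter, Finset.mem_univ, true_and, Finset.mem_compl]
  by_cases hi : i ∈ S <;> simp [hi]

/-- `mkWord` is injective -/
theorem mkWord_injective : Function.Injective (mkWord k) := by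
  intro S T h
  rw [← redSet_mkWord k S, ← redSet_mkWord k T, h]

/-- a word with `nR + nB = k` is the all-crossing word of its reds -/
theorem eq_mkWord_of_full (w : Fin k → Ltr) (h : nR k w + nB k w = k) : w = mkWord k (redSet k w) := by
  have hcov : redSet k w ∪ blueSet k w = Finset.univ := by
    apply Finset.eq_univ_of_card
    rw [Finset.card_union_of_disjoint]
    · rw [← nR_eq_card_redSet, ← nB_eq_card_blueSet, h]; simp
    · rw [Finset.disjoint_left]
      intro i h1 h2
      simp only [redSet, blueSet, Finset.mem_filter, Finset.mem_univ, true_and] at h1 h2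
      rw [h1] at h2
      exact Ltr.noConfusion h2
  ext i
  simp only [mkWord]
  by_cases hi : i ∈ redSet k w
  · rw [if_pos hi]
    simp only [redSet, Finset.mem_filter, Finset.mem_univ, true_and] at hi
    exact hi
  · rw [if_neg hi]
    have : i ∈ redSet k w ∪ blueSet k w := by rw [hcov]; exact Finset.mem_univ i
    rcases Finset.mem_union.1 this with h' | h'
    · exact absurd h' hi
    · simp only [blueSet, Finset.mem_filter, Finset.mem_univ, true_and] at h'
      exact h'

/-- the words with exactly `r` reds and `k − r` blues -/
theorem filter_full_eq_image (r : ℕ) (hr : r ≤ k) :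
    (Finset.univ.filter (fun w : Fin k → Ltr => nR k w = r ∧ nB k w = k - r))
      = ((Finset.univ : Finset (Fin k)).powersetCard r).image (mkWord k) := by
  ext w
  simp only [Finset.mem_filter, Finset.mem_univ, true_and, Finset.mem_image, Finset.mem_powersetCard,
    Finset.subset_univ]
  constructor
  · rintro ⟨h1, h2⟩
    refine ⟨redSet k w, ?_, ?_⟩
    · rw [← nR_eq_card_redSet, h1]
    · exact (eq_mkWord_of_full k w (by omega)).symm
  · rintro ⟨S, hS, rfl⟩
    constructor
    · rw [nR_eq_card_redSet, redSet_mkWord, hS]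
    · rw [nB_eq_card_blueSet, blueSet_mkWord, Finset.card_compl, hS]; simp

/-- the number of words with exactly `r` reds and `k − r` blues is `C(k, r)` -/
theorem card_filter_full (r : ℕ) (hr : r ≤ k) :
    (Finset.univ.filter (fun w : Fin k → Ltr => nR k w = r ∧ nB k w = k - r)).card = k.choose r := by
  rw [filter_full_eq_image k r hr, Finset.card_image_of_injective _ (mkWord_injective k), Finset.card_powersetCard]
  simp

end Words

section Counts

variable (k : ℕ) (X : Fin k → V2Closure.SP)

/-- the block of an all-crossing word has size `Π #R_i` -/
theorem card_blockOf_full (w : Fin k → Ltr) (h : nR k w + nB k w = k) :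
    (blockOf k X w).card = ∏ i, (rSet (X i)).card := by
  rw [card_blockOf]
  refine Finset.prod_congr rfl (fun i _ => ?_)
  have hw := eq_mkWord_of_full k w h
  rw [hw]
  simp only [mkWord]
  by_cases hi : i ∈ redSet k w
  · rw [if_pos hi]; rfl
  · rw [if_neg hi]
    exact (card_letterSet_R_eq_B (X i)).symm

/-- the top-level tails: `|E(u, k−u)| = C(k,u)·Π #R_i` -/
theorem tailCount_parFin_top (hX : ∀ i, FlowOne (X i)) (u : ℕ) (hu : u ≤ k) :
    tailCount (parFin k X) u (k - u) = k.choose u * ∏ i, (rSet (X i)).card := by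
  rw [tailCount_parFin_eq_sum k X hX]
  have hfilt : (Finset.univ.filter (fun w : Fin k → Ltr => u ≤ nR k w ∧ k - u ≤ nB k w))
      = Finset.univ.filter (fun w : Fin k → Ltr => nR k w = u ∧ nB k w = k - u) := by
    ext w
    simp only [Finset.mem_filter, Finset.mem_univ, true_and]
    have := nR_add_nB_le k w
    omega
  rw [hfilt]
  rw [Finset.sum_congr rfl (fun w hw => card_blockOf_full k X w (by
    simp only [Finset.mem_filter, Finset.mem_univ, true_and] at hw; omega))]
  rw [Finset.sum_const, card_filter_full k u hu, smul_eq_mul]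

end Counts

section Top

variable (k : ℕ) (X : Fin k → V2Closure.SP) (u : ℕ)

/-- a top-level index: an all-crossing word with `u` reds and one of its red positions -/
abbrev isTop (w : Fin k → Ltr) (J : Finset (Fin k)) : Prop :=
  nR k w = u ∧ nB k w = k - u ∧ J ⊆ redSet k w ∧ J.card = 1

/-- the source block of a top-level index -/
def topP (w : Fin k → Ltr) (J : Finset (Fin k)) : Finset (parFin k X).Conf :=
  if isTop k u w J then blockOf k X w else ∅

/-- the target block of a top-level index -/
def topQ (w : Fin k → Ltr) (J : Finset (Fin k)) : Finset (parFin k X).Conf :=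
  if isTop k u w J then blockOf k X (flipSet k w J) else ∅

/-- the weight of a top-level index: `|w| / (|E|·u)` -/
noncomputable def topW (w : Fin k → Ltr) (J : Finset (Fin k)) : ℚ :=
  if isTop k u w J then ((blockOf k X w).card : ℚ) / (tailCount (parFin k X) u (k - u) * u) else 0

/-- the weights are non-negative -/
theorem topW_nonneg (w : Fin k → Ltr) (J : Finset (Fin k)) : 0 ≤ topW k X u w J := by
  unfold topW
  split_ifs <;> positivity

/-- every top-level index is a product coupling -/
theorem topP_dom (w : Fin k → Ltr) (J : Finset (Fin k)) :
    BlockDom (parFin k X) (topP k X u w J) (topQ k X u w J) := by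
  unfold topP topQ
  by_cases h : isTop k u w J
  · rw [if_pos h, if_pos h]
    exact blockOf_dom k X w _ (flipSet_dom_cond k w J h.2.2.1)
  · rw [if_neg h, if_neg h]
    exact blockDom_refl _ _

/-- a target block is non-empty when its source block is -/
theorem topQ_nonempty (w : Fin k → Ltr) (J : Finset (Fin k)) (_ : 0 < topW k X u w J)
    (hP : (topP k X u w J).Nonempty) : (topQ k X u w J).Nonempty := by
  unfold topP at hP
  unfold topQ
  by_cases h : isTop k u w J
  · rw [if_pos h] at hP
    rw [if_pos h]
    apply Finset.card_pos.1
    rw [card_blockOf_flipSet k X w J h.2.2.1]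
    exact Finset.card_pos.2 hP
  · rw [if_neg h] at hP
    exact absurd hP Finset.not_nonempty_empty

/-- the source coverage of the top-level certificate -/
theorem top_src_cov (hX : ∀ i, FlowOne (X i)) (hu : 1 ≤ u) (huk : u ≤ k) (z : (parFin k X).Conf) :
    ∑ p : (Fin k → Ltr) × Finset (Fin k), topW k X u p.1 p.2 * unifDens (parFin k X) (topP k X u p.1 p.2) z
      = unifDens (parFin k X) (tailSet (parFin k X) u (k - u)) z := by
  set w0 := wordOf k X z with hw0
  set E : ℚ := (tailCount (parFin k X) u (k - u) : ℚ) with hE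
  have hpos : (0 : ℚ) < (blockOf k X w0).card := by exact_mod_cast card_blockOf_wordOf_pos k X hX z
  have hdens : ∀ (w : Fin k → Ltr) (J : Finset (Fin k)),
      topW k X u w J * unifDens (parFin k X) (topP k X u w J) z
        = if isTop k u w J ∧ w0 = w then (E * u)⁻¹ else 0 := by
    intro w J
    unfold topW topP
    rw [← hE]
    by_cases h : isTop k u w J
    · rw [if_pos h, if_pos h, unifDens_blockOf k X hX]
      by_cases hw : w0 = w
      · rw [if_pos (show wordOf k X z = w from hw), if_pos ⟨h, hw⟩]
        rw [hw] at hpos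
        rcases eq_or_ne E 0 with hE0 | hE0
        · rw [hE0]; simp
        · field_simp
      · rw [if_neg (show ¬ (wordOf k X z = w) from fun hh => hw hh), mul_zero,
          if_neg (fun hh => hw hh.2)]
    · rw [if_neg h, zero_mul, if_neg (fun hh => h hh.1)]
  have hR : unifDens (parFin k X) (tailSet (parFin k X) u (k - u)) z
      = if nR k w0 = u ∧ nB k w0 = k - u then E⁻¹ else 0 := by
    unfold unifDens
    rw [hE, tailCount_eq_card]
    have hmem : z ∈ tailSet (parFin k X) u (k - u) ↔ nR k w0 = u ∧ nB k w0 = k - u := by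
      rw [mem_tailSet_parFin k X hX, ← hw0]
      have := nR_add_nB_le k w0
      omega
    by_cases h : z ∈ tailSet (parFin k X) u (k - u)
    · rw [if_pos h, if_pos (hmem.1 h)]
    · rw [if_neg h, if_neg (fun hh => h (hmem.2 hh))]
  rw [Finset.sum_congr rfl (fun p _ => hdens p.1 p.2), Fintype.sum_prod_type, Finset.sum_eq_single w0, hR]
  · by_cases hc : nR k w0 = u ∧ nB k w0 = k - u
    · rw [if_pos hc]
      have hterm : ∀ J : Finset (Fin k), (if isTop k u w0 J ∧ w0 = w0 then (E * u)⁻¹ else 0)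
          = if J ∈ (redSet k w0).powersetCard 1 then (E * u)⁻¹ else 0 := by
        intro J
        by_cases hJ : J ∈ (redSet k w0).powersetCard 1
        · rw [Finset.mem_powersetCard] at hJ
          rw [if_pos ⟨⟨hc.1, hc.2, hJ.1, hJ.2⟩, rfl⟩, if_pos (Finset.mem_powersetCard.2 hJ)]
        · rw [if_neg (fun h => hJ (Finset.mem_powersetCard.2 ⟨h.1.2.2.1, h.1.2.2.2⟩)), if_neg hJ]
      rw [Finset.sum_congr rfl (fun J _ => hterm J), Finset.sum_ite_mem, Finset.univ_inter, Finset.sum_const,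
        Finset.card_powersetCard, ← nR_eq_card_redSet, hc.1, Nat.choose_one_right, nsmul_eq_mul]
      have hu' : (0 : ℚ) < u := by exact_mod_cast hu
      rcases eq_or_ne E 0 with hE0 | hE0
      · rw [hE0]; simp
      · field_simp
    · rw [if_neg hc]
      apply Finset.sum_eq_zero
      intro J _
      rw [if_neg (fun h => hc ⟨h.1.1, h.1.2.1⟩)]
  · intro w _ hw
    apply Finset.sum_eq_zero
    intro J _
    rw [if_neg (fun h => hw h.2.symm)]
  · intro h; exact absurd (Finset.mem_univ _) h

/-- the density of a top-level target block at a configuration -/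
theorem unifDens_topQ (hX : ∀ i, FlowOne (X i)) (w : Fin k → Ltr) (J : Finset (Fin k)) (z : (parFin k X).Conf) :
    unifDens (parFin k X) (topQ k X u w J) z
      = if isTop k u w J then
          (if wordOf k X z = flipSet k w J then ((blockOf k X (flipSet k w J)).card : ℚ)⁻¹ else 0)
        else 0 := by
  unfold topQ
  by_cases h : isTop k u w J
  · rw [if_pos h, if_pos h, unifDens_blockOf k X hX]
  · rw [if_neg h, if_neg h, unifDens_empty]

/-- the binomial identity of the top level: `C(k, u−1)·(k−u+1) = C(k,u)·u` -/
theorem choose_top_identity (hu : 1 ≤ u) (huk : u ≤ k) :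
    (k.choose (u - 1) : ℚ) * ((k - u + 1 : ℕ) : ℚ) = (k.choose u : ℚ) * u := by
  have h := Nat.choose_succ_right_eq k (u - 1)
  have e1 : u - 1 + 1 = u := by omega
  have e2 : k - (u - 1) = k - u + 1 := by omega
  rw [e1, e2] at h
  exact_mod_cast h.symm

/-- the target coverage of the top-level certificate -/
theorem top_tgt_cov (hX : ∀ i, FlowOne (X i)) (hu : 1 ≤ u) (huk : u ≤ k) (z : (parFin k X).Conf) :
    ∑ p : (Fin k → Ltr) × Finset (Fin k), topW k X u p.1 p.2 * unifDens (parFin k X) (topQ k X u p.1 p.2) z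
      = unifDens (parFin k X) (tailSet (parFin k X) (u - 1) (k - u + 1)) z := by
  set w1 := wordOf k X z with hw1
  set E : ℚ := (tailCount (parFin k X) u (k - u) : ℚ) with hE
  set A : ℚ := ∏ i, ((rSet (X i)).card : ℚ) with hA
  have hpos : (0 : ℚ) < (blockOf k X w1).card := by exact_mod_cast card_blockOf_wordOf_pos k X hX z
  have hEeq : E = (k.choose u : ℚ) * A := by
    rw [hE, tailCount_parFin_top k X hX u huk, hA]; push_cast; ring
  have hE'eq : (tailCount (parFin k X) (u - 1) (k - u + 1) : ℚ) = (k.choose (u - 1) : ℚ) * A := by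
    have := tailCount_parFin_top k X hX (u - 1) (by omega)
    have e : k - (u - 1) = k - u + 1 := by omega
    rw [e] at this
    rw [this, hA]; push_cast; ring
  -- each term
  have hterm : ∀ (w : Fin k → Ltr) (J : Finset (Fin k)),
      topW k X u w J * unifDens (parFin k X) (topQ k X u w J) z
        = if isTop k u w J ∧ w1 = flipSet k w J then (E * u)⁻¹ else 0 := by
    intro w J
    rw [unifDens_topQ k X u hX]
    unfold topW
    rw [← hE]
    by_cases h : isTop k u w J
    · rw [if_pos h, if_pos h]
      by_cases hw : w1 = flipSet k w J
      · rw [if_pos (show wordOf k X z = flipSet k w J from hw), if_pos ⟨h, hw⟩,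
          card_blockOf_flipSet k X w J h.2.2.1]
        have hpos' : (0 : ℚ) < (blockOf k X w).card := by
          rw [← card_blockOf_flipSet k X w J h.2.2.1, ← hw]; exact hpos
        rcases eq_or_ne E 0 with hE0 | hE0
        · rw [hE0]; simp
        · have hu' : (u : ℚ) ≠ 0 := by exact_mod_cast (by omega : u ≠ 0)
          field_simp
      · rw [if_neg (show ¬ (wordOf k X z = flipSet k w J) from fun hh => hw hh), mul_zero,
          if_neg (fun hh => hw hh.2)]
    · rw [if_neg h, zero_mul, if_neg (fun hh => h hh.1)]
  rw [Finset.sum_congr rfl (fun p _ => hterm p.1 p.2), Fintype.sum_prod_type, Finset.sum_comm]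
  -- for a fixed `J`, only `w = unflip w1 J` contributes
  have hJ : ∀ J : Finset (Fin k), ∑ w : Fin k → Ltr, (if isTop k u w J ∧ w1 = flipSet k w J then (E * u)⁻¹ else 0)
      = if J ∈ (blueSet k w1).powersetCard 1 ∧ nR k w1 + 1 = u ∧ nB k w1 = k - u + 1 then (E * u)⁻¹ else 0 := by
    intro J
    rw [Finset.sum_eq_single (unflip k w1 J)]
    · by_cases hc : J ∈ (blueSet k w1).powersetCard 1 ∧ nR k w1 + 1 = u ∧ nB k w1 = k - u + 1
      · rw [if_pos hc]
        obtain ⟨hJm, hr1, hb1⟩ := hc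
        rw [Finset.mem_powersetCard] at hJm
        have hnR := nR_unflip k w1 J hJm.1
        have hnB := nB_unflip k w1 J hJm.1
        have hfl := flipSet_unflip_eq k w1 J hJm.1
        rw [if_pos ⟨⟨by omega, by omega, unflip_sub_redSet k w1 J, hJm.2⟩, hfl.symm⟩]
      · rw [if_neg hc, if_neg]
        rintro ⟨ht, hfl⟩
        apply hc
        have hJb : J ⊆ blueSet k w1 := sub_blueSet_of_flipSet k _ w1 J hfl.symm
        have hnR := nR_unflip k w1 J hJb
        have hnB := nB_unflip k w1 J hJb
        have h1 := ht.1; have h2 := ht.2.1; have h4 := ht.2.2.2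
        refine ⟨Finset.mem_powersetCard.2 ⟨hJb, h4⟩, ?_, ?_⟩ <;> omega
    · intro w _ hw
      rw [if_neg]
      rintro ⟨ht, hfl⟩
      exact hw (eq_unflip_of_flipSet k w w1 J ht.2.2.1 hfl.symm)
    · intro h; exact absurd (Finset.mem_univ _) h
  rw [Finset.sum_congr rfl (fun J _ => hJ J)]
  -- the right-hand side
  have hR : unifDens (parFin k X) (tailSet (parFin k X) (u - 1) (k - u + 1)) z
      = if nR k w1 + 1 = u ∧ nB k w1 = k - u + 1 then ((k.choose (u - 1) : ℚ) * A)⁻¹ else 0 := by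
    unfold unifDens
    rw [tailCount_eq_card] at hE'eq
    rw [hE'eq]
    have hmem : z ∈ tailSet (parFin k X) (u - 1) (k - u + 1) ↔ nR k w1 + 1 = u ∧ nB k w1 = k - u + 1 := by
      rw [mem_tailSet_parFin k X hX, ← hw1]
      have := nR_add_nB_le k w1
      omega
    by_cases h : z ∈ tailSet (parFin k X) (u - 1) (k - u + 1)
    · rw [if_pos h, if_pos (hmem.1 h)]
    · rw [if_neg h, if_neg (fun hh => h (hmem.2 hh))]
  rw [hR]
  by_cases hc : nR k w1 + 1 = u ∧ nB k w1 = k - u + 1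
  · rw [if_pos hc]
    have hterm' : ∀ J : Finset (Fin k), (if J ∈ (blueSet k w1).powersetCard 1 ∧ nR k w1 + 1 = u
        ∧ nB k w1 = k - u + 1 then (E * u)⁻¹ else 0)
        = if J ∈ (blueSet k w1).powersetCard 1 then (E * u)⁻¹ else 0 := by
      intro J
      by_cases hJ : J ∈ (blueSet k w1).powersetCard 1
      · rw [if_pos ⟨hJ, hc⟩, if_pos hJ]
      · rw [if_neg (fun h => hJ h.1), if_neg hJ]
    rw [Finset.sum_congr rfl (fun J _ => hterm' J), Finset.sum_ite_mem, Finset.univ_inter, Finset.sum_const,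
      Finset.card_powersetCard, ← nB_eq_card_blueSet, hc.2, Nat.choose_one_right, nsmul_eq_mul, hEeq]
    have hid := choose_top_identity k u hu huk
    rcases eq_or_ne A 0 with hA0 | hA0
    · rw [hA0]; simp
    · have hu' : (u : ℚ) ≠ 0 := by exact_mod_cast (by omega : u ≠ 0)
      have hC : (k.choose u : ℚ) ≠ 0 := by exact_mod_cast (Nat.choose_pos huk).ne'
      have hC' : (k.choose (u - 1) : ℚ) ≠ 0 := by exact_mod_cast (Nat.choose_pos (by omega)).ne'
      field_simp
      linear_combination hid
  · rw [if_neg hc]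
    apply Finset.sum_eq_zero
    intro J _
    rw [if_neg (fun h => hc h.2)]

/-- **(SD) at every top-level position `(u, k−u)`, `1 ≤ u ≤ k`, on the parallel composition of `k` flow-one
factors, for every `k`**: every source configuration flips a uniformly random one of its `u` red factors -/
theorem sdomZ_parFin_top (hX : ∀ i, FlowOne (X i)) (hu : 1 ≤ u) (huk : u ≤ k) :
    SDomZ (parFin k X) (u : ℤ) ((k - u : ℕ) : ℤ) := by
  rw [sdomZ_iff_blockDom]
  have e1 : ((u : ℤ)).toNat = u := by omega
  have e2 : (((k - u : ℕ) : ℤ)).toNat = k - u := by omega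
  have e3 : ((u : ℤ) - 1).toNat = u - 1 := by omega
  have e4 : (((k - u : ℕ) : ℤ) + 1).toNat = k - u + 1 := by omega
  rw [e1, e2, e3, e4]
  exact blockDom_of_mixture (parFin k X) (fun p : (Fin k → Ltr) × Finset (Fin k) => topP k X u p.1 p.2)
    (fun p => topQ k X u p.1 p.2) (fun p => topW k X u p.1 p.2) (fun p => topW_nonneg k X u p.1 p.2)
    (fun p => topP_dom k X u p.1 p.2) (fun p => topQ_nonempty k X u p.1 p.2) _ _
    (top_src_cov k X u hX hu huk) (top_tgt_cov k X u hX hu huk)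

end Top

end Summit.Ventures.PercRepro2.Tail2D
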